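import Literature.Geometry.Lorentzian.CoordShrinkerRicciLaplacian
import Literature.Geometry.Lorentzian.CoordRicciNormEvolution
import Literature.Geometry.Lorentzian.CoordCurvatureNormSq
import Literature.Geometry.Lorentzian.CoordSigma2Linearization
import HarnessLib

/-!
# `Δ_f |Ric|² ≥ 2|∇Ric|² + 4λ|Ric|² − 4|Rm| |Ric|²` on a gradient Ricci soliton, in coordinates

Continuation of `CoordShrinkerRicciLaplacian.lean` (metric components `G : E → (E →L E →L ℝ)`,
smooth, symmetric and nondegenerate on an open set `V`, `IsMetricOn G V`; a smooth `f : E → ℝ`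
with the gradient Ricci soliton equation `Ric + Hess f = λ G` on `V`; `∇f = ♯Df`, `∇Ric = cov₂At`,
rough Laplacian `ΔRic = lapBilinAt`, Laplace–Beltrami operator `Δ = lapAt`, pairing of bilinear
forms `⟨·,·⟩_G = pairAt`, `|·|²_G = normSqAt`, `|Rm|²_G = rmNormSqAt`). We PROVE the first line
of the proof of Munteanu–Wang 2015, Lemma 1.2 (their formula (1.10) = (F1),
"`Δ_f |Ric|² ≥ 2|∇Ric|² − c|Rm| |Ric|²`", with the explicit constant `c = 4`), at a point `x ∈ V`
where `G x` is positive definite: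

* `IsMetricOn.pairAt_ricAt_lapBilinAt_of_soliton` — pairing Hamilton's identity
  `ΔRic = ∇_{∇f}Ric + 2λRic − 2Rm(Ric)` (`IsMetricOn.lapBilinAt_ricAt_of_soliton`) with `Ric`:
  `⟨Ric, ΔRic⟩ = ⟨Ric, ∇_{∇f}Ric⟩ + 2λ|Ric|² − 2⟨Rm(Ric), Ric⟩`, the last pairing written in a
  basis `b'` as `Σ g^{kl} Σ g^{ij} Ric(R(b'ᵢ, ♯Ric(b'_k)) b'_l, b'ⱼ)`;
* `IsMetricOn.lapAt_normSqAt_ricAt_sub_fderiv_of_soliton` — **the drift identity**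
  `Δ|Ric|² − d|Ric|²(∇f) = 2|∇Ric|² + 4λ|Ric|² − 4⟨Rm(Ric), Ric⟩`
  (the Bochner formula `IsMetricOn.lapAt_normSqAt` and `d|Ric|²(W) = 2⟨Ric, ∇_W Ric⟩`,
  `IsMetricOn.fderiv_pairAt`), with `|∇Ric|² = Σ g^{kl}⟨∇_{b_k}Ric, ∇_{b_l}Ric⟩` in any basis `b`;
* `abs_sum_quartic_le`, `IsMetricOn.abs_rmRic_ricAt_le_of_orthonormal` — the Cauchy–Schwarz
  estimate `|⟨Rm(Ric), Ric⟩| ≤ |Rm| |Ric|²` in a `G x`-orthonormal frame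
  (`⟨Rm(Ric),Ric⟩ = Σ R_{imkj} Ric_{km} Ric_{ij}`, `|Rm|² = Σ R_{acij}²`, `|Ric|² = Σ Ric_{ij}²`);
* `IsMetricOn.lapAt_normSqAt_ricAt_sub_fderiv_ge_of_soliton` — **the inequality**
  `Δ|Ric|² − d|Ric|²(∇f) ≥ 2|∇Ric|² + 4λ|Ric|² − 4 √(|Rm|²) |Ric|²`, and its normalised-shrinker
  form (`λ = ½`) `IsMetricOn.lapAt_normSqAt_ricAt_sub_fderiv_ge_of_shrinker`:
  `Δ_f|Ric|² ≥ 2|∇Ric|² + 2|Ric|² − 4|Rm| |Ric|²`.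

Everything is proved; no definition and no statement of `Prop` type is introduced.

## References

* O. Munteanu, J. Wang, *Geometry of shrinking Ricci solitons*, Compositio Math. 151 (2015),
  2273–2300 = arXiv:1410.3813, §1, Lemma 1.2 and the first display of its proof ((1.10) = (F1)),
  and the identity `Δ_f R_{ij} = R_{ij} − 2R_{ikjl}R_{kl}` recalled before (1.5). [MunteanuWang2015]
* R. S. Hamilton, *Three-manifolds with positive Ricci curvature*, J. Differential Geom. 17
  (1982), 255–306, §7 (Cor. 7.3, Lemma 7.4), §11 (Lemma 11.2). [Hamilton1982]
* O. Munteanu, J. Wang, *Structure at infinity for shrinking Ricci solitons*, arXiv:1606.01861,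
  §2 (p. 6). [MunteanuWang2016]
* B. O'Neill, *Semi-Riemannian geometry with applications to relativity*, 1983, Ch. 2,
  Lemma 2.25; Ch. 3, pp. 60–61, 86. [ONeill1983]
-/

noncomputable section

set_option maxSynthPendingDepth 3

open Set Filter ContinuousLinearMap Module
open scoped Topology ContDiff

namespace Literature.Geometry.Lorentzian

namespace MetricCoord

variable {E : Type*} [NormedAddCommGroup E] [NormedSpace ℝ E] [FiniteDimensional ℝ E]
  [CompleteSpace E] {G : E → E →L[ℝ] E →L[ℝ] ℝ} {V : Set E} {x : E} {f : E → ℝ} {lam : ℝ}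

/-! ### `⟨Ric, ΔRic⟩` on a soliton and the drift identity for `|Ric|²` -/

/-- **`⟨Ric, ΔRic⟩ = ⟨Ric, ∇_{∇f}Ric⟩ + 2λ|Ric|² − 2⟨Rm(Ric), Ric⟩` on a gradient Ricci soliton**:
Hamilton's identity `ΔRic = ∇_{♯Df}Ric + 2λRic − 2Rm(Ric)` (`IsMetricOn.lapBilinAt_ricAt_of_soliton`,
Munteanu–Wang: `Δ_f R_{ij} = R_{ij} − 2R_{ikjl}R_{kl}` for `λ = ½`) paired with `Ric` in a basis
`b` (`pairAt_eq_sum_ginv`); the curvature pairing `⟨Rm(Ric), Ric⟩` is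
`Σ_{kl} g^{kl} Σ_{ij} g^{ij} Ric(R(bᵢ, ♯Ric(b_k)) b_l, bⱼ)`.
[cite: MunteanuWang2015, Lemma 1.2 (proof, (F1))] [cite: Hamilton1982, §11, Lemma 11.2] -/
theorem IsMetricOn.pairAt_ricAt_lapBilinAt_of_soliton {ι : Type*} [Fintype ι] (b : Basis ι ℝ E)
    (hG : IsMetricOn G V) (hx : x ∈ V) (hf : ContDiffOn ℝ ∞ f V)
    (hsol : ∀ y ∈ V, ∀ v w, ricAt G y v w + hessAt G f y v w = lam * G y v w) :
    pairAt G x (ricAt G x) (lapBilinAt G (ricAt G) x) =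
      pairAt G x (ricAt G x) (cov₂At G (ricAt G) x (sharpAt G x (fderiv ℝ f x)))
        + 2 * lam * normSqAt G x (ricAt G x)
        - 2 * ∑ k, ∑ l, ginv G b x k l * ∑ i, ∑ j, ginv G b x i j *
            ricAt G x (riemAt G x (b i) (sharpAt G x (ricAt G x (b k))) (b l)) (b j) := by
  have hRs : ∀ v w, ricAt G x v w = ricAt G x w v := hG.ricAt_comm hx
  rw [pairAt_comm G x (ricAt G x) (lapBilinAt G (ricAt G) x),
    pairAt_eq_sum_ginv b (lapBilinAt G (ricAt G) x) (ricAt G x),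
    pairAt_comm G x (ricAt G x) (cov₂At G (ricAt G) x (sharpAt G x (fderiv ℝ f x))),
    pairAt_eq_sum_ginv b (cov₂At G (ricAt G) x (sharpAt G x (fderiv ℝ f x))) (ricAt G x),
    ← pairAt_self_of_symm G x hRs, pairAt_eq_sum_ginv b (ricAt G x) (ricAt G x)]
  have hterm : ∀ k l, ginv G b x k l *
      lapBilinAt G (ricAt G) x (sharpAt G x (ricAt G x (b k))) (b l) =
      ginv G b x k l * cov₂At G (ricAt G) x (sharpAt G x (fderiv ℝ f x))
          (sharpAt G x (ricAt G x (b k))) (b l)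
        + 2 * lam * (ginv G b x k l * ricAt G x (sharpAt G x (ricAt G x (b k))) (b l))
        - 2 * (ginv G b x k l * ∑ i, ∑ j, ginv G b x i j *
            ricAt G x (riemAt G x (b i) (sharpAt G x (ricAt G x (b k))) (b l)) (b j)) := by
    intro k l
    rw [hG.lapBilinAt_ricAt_of_soliton b hx hf hsol]
    ring
  simp only [hterm, Finset.sum_add_distrib, Finset.sum_sub_distrib, ← Finset.mul_sum]

/-- **The drift identity `Δ|Ric|² − d|Ric|²(∇f) = 2|∇Ric|² + 4λ|Ric|² − 4⟨Rm(Ric), Ric⟩` on a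
gradient Ricci soliton** (Munteanu–Wang 2015, proof of Lemma 1.2, the computation behind (F1):
`Δ_f|Ric|² = 2|∇Ric|² + 2|Ric|² − 4R_{ikjl}R_{kl}R_{ij}` for `λ = ½`; Hamilton 1982, Lemma 11.2 for
the flow version). Here `|∇Ric|² = Σ_{kl} g^{kl}⟨∇_{b_k}Ric, ∇_{b_l}Ric⟩_G` in any basis `b`
(the Bochner formula `IsMetricOn.lapAt_normSqAt`), the drift is `d|Ric|²(♯Df) = 2⟨Ric, ∇_{♯Df}Ric⟩`
(`IsMetricOn.fderiv_pairAt`), and the curvature pairing is written in a second basis `b'`.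
[cite: MunteanuWang2015, Lemma 1.2 (proof, (F1))] [cite: Hamilton1982, §11, Lemma 11.2] -/
theorem IsMetricOn.lapAt_normSqAt_ricAt_sub_fderiv_of_soliton {ι ι' : Type*} [Fintype ι]
    [Fintype ι'] (b : Basis ι ℝ E) (b' : Basis ι' ℝ E) (hG : IsMetricOn G V) (hx : x ∈ V)
    (hf : ContDiffOn ℝ ∞ f V)
    (hsol : ∀ y ∈ V, ∀ v w, ricAt G y v w + hessAt G f y v w = lam * G y v w) :
    lapAt G (fun y ↦ normSqAt G y (ricAt G y)) x
        - fderiv ℝ (fun y ↦ normSqAt G y (ricAt G y)) x (sharpAt G x (fderiv ℝ f x)) =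
      2 * (∑ k, ∑ l, ginv G b x k l *
          pairAt G x (cov₂At G (ricAt G) x (b k)) (cov₂At G (ricAt G) x (b l)))
        + 4 * lam * normSqAt G x (ricAt G x)
        - 4 * ∑ k, ∑ l, ginv G b' x k l * ∑ i, ∑ j, ginv G b' x i j *
            ricAt G x (riemAt G x (b' i) (sharpAt G x (ricAt G x (b' k))) (b' l)) (b' j) := by
  have hRd := hG.differentiableAt_ricAt hx
  have hev : (fun y ↦ normSqAt G y (ricAt G y)) =ᶠ[𝓝 x]
      fun y ↦ pairAt G y (ricAt G y) (ricAt G y) :=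
    (hG.eventually_mem hx).mono fun y hy ↦ (pairAt_self_of_symm G y (hG.ricAt_comm hy)).symm
  rw [hG.lapAt_normSqAt b hx hG.contDiffOn_ricAt (fun y hy ↦ hG.ricAt_comm hy), hev.fderiv_eq,
    hG.fderiv_pairAt hx hRd hRd, hG.pairAt_ricAt_lapBilinAt_of_soliton b' hx hf hsol,
    pairAt_comm G x (cov₂At G (ricAt G) x (sharpAt G x (fderiv ℝ f x))) (ricAt G x)]
  ring

/-! ### Cauchy–Schwarz: `|⟨Rm(Ric), Ric⟩| ≤ |Rm| |Ric|²` in an orthonormal frame -/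

omit [NormedAddCommGroup E] [NormedSpace ℝ E] [FiniteDimensional ℝ E] [CompleteSpace E] in
/-- The Cauchy–Schwarz step behind `|R_{ikjl}R_{kl}R_{ij}| ≤ |Rm| |Ric|²`: for real arrays
`R_{acij}`, `r_{ij}`, `|Σ_{kimj} R_{imkj} r_{km} r_{ij}| ≤ √(Σ R_{acij}²) · Σ r_{ij}²` (Cauchy–Schwarz
over the quadruple index, `Σ (r_{km} r_{ij})² = (Σ r²)²`). [folklore] -/
theorem abs_sum_quartic_le {ι : Type*} [Fintype ι] (R : ι → ι → ι → ι → ℝ) (r : ι → ι → ℝ) :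
    |∑ k, ∑ i, ∑ m, ∑ j, R i m k j * (r k m * r i j)| ≤
      Real.sqrt (∑ a, ∑ c, ∑ i, ∑ j, R a c i j ^ 2) * ∑ i, ∑ j, r i j ^ 2 := by
  have hCS := sq_sum_mul_le (ι := ι × ι × ι × ι) (fun p ↦ R p.2.1 p.2.2.1 p.1 p.2.2.2)
    (fun p ↦ r p.1 p.2.2.1 * r p.2.1 p.2.2.2)
  simp only [Fintype.sum_prod_type] at hCS
  have hRm : ∑ k, ∑ i, ∑ m, ∑ j, R i m k j ^ 2 = ∑ a, ∑ c, ∑ i, ∑ j, R a c i j ^ 2 := by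
    calc ∑ k, ∑ i, ∑ m, ∑ j, R i m k j ^ 2 = ∑ i, ∑ k, ∑ m, ∑ j, R i m k j ^ 2 := Finset.sum_comm
      _ = ∑ i, ∑ m, ∑ k, ∑ j, R i m k j ^ 2 := Finset.sum_congr rfl fun i _ ↦ Finset.sum_comm
  have hr : ∑ k, ∑ i, ∑ m, ∑ j, (r k m * r i j) ^ 2 = (∑ i, ∑ j, r i j ^ 2) ^ 2 := by
    rw [sq (∑ i, ∑ j, r i j ^ 2), Finset.sum_mul_sum]
    refine Finset.sum_congr rfl fun k _ ↦ Finset.sum_congr rfl fun i _ ↦ ?_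
    rw [Finset.sum_mul_sum]
    exact Finset.sum_congr rfl fun m _ ↦ Finset.sum_congr rfl fun j _ ↦ by ring
  have h0 : 0 ≤ ∑ i, ∑ j, r i j ^ 2 :=
    Finset.sum_nonneg fun _ _ ↦ Finset.sum_nonneg fun _ _ ↦ sq_nonneg _
  have hR0 : 0 ≤ ∑ a, ∑ c, ∑ i, ∑ j, R a c i j ^ 2 :=
    Finset.sum_nonneg fun _ _ ↦ Finset.sum_nonneg fun _ _ ↦ Finset.sum_nonneg fun _ _ ↦
      Finset.sum_nonneg fun _ _ ↦ sq_nonneg _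
  rw [hRm, hr] at hCS
  calc |∑ k, ∑ i, ∑ m, ∑ j, R i m k j * (r k m * r i j)|
      ≤ Real.sqrt ((∑ a, ∑ c, ∑ i, ∑ j, R a c i j ^ 2) * (∑ i, ∑ j, r i j ^ 2) ^ 2) :=
        Real.abs_le_sqrt hCS
    _ = Real.sqrt (∑ a, ∑ c, ∑ i, ∑ j, R a c i j ^ 2) * ∑ i, ∑ j, r i j ^ 2 := by
        rw [Real.sqrt_mul hR0, Real.sqrt_sq h0]

/-- **`|⟨Rm(Ric), Ric⟩| ≤ |Rm| |Ric|²`** (the estimate `−4R_{ikjl}R_{kl}R_{ij} ≥ −c|Rm||Ric|²` of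
Munteanu–Wang 2015, proof of Lemma 1.2, with `c = 4` after the factor `4`): in a
`G x`-orthonormal basis `e` at `x ∈ V` the curvature pairing
`Σ_{kl} g^{kl} Σ_{ij} g^{ij} Ric(R(eᵢ, ♯Ric(e_k)) e_l, eⱼ) = Σ R_{imkj} Ric_{km} Ric_{ij}` is bounded in
absolute value by `√(|Rm|²_G) · |Ric|²_G` (`rmNormSqAt_eq_sum_sq`, `normSqAt_eq_sum_frame`,
`abs_sum_quartic_le`). [cite: MunteanuWang2015, Lemma 1.2 (proof, (F1))] -/
theorem IsMetricOn.abs_rmRic_ricAt_le_of_orthonormal {ι : Type*} [Fintype ι] [DecidableEq ι]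
    (e : Basis ι ℝ E) (he : ∀ i j, G x (e i) (e j) = if i = j then 1 else 0)
    (hG : IsMetricOn G V) (hx : x ∈ V) :
    |∑ k, ∑ l, ginv G e x k l * ∑ i, ∑ j, ginv G e x i j *
        ricAt G x (riemAt G x (e i) (sharpAt G x (ricAt G x (e k))) (e l)) (e j)| ≤
      Real.sqrt (rmNormSqAt G x) * normSqAt G x (ricAt G x) := by
  have hi := hG.isInvertible x hx
  have hs := hG.symm x hx
  -- the frame expansion of one term of the curvature pairing
  have h2 : ∀ k i, ricAt G x (riemAt G x (e i) (sharpAt G x (ricAt G x (e k))) (e k)) (e i) =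
      ∑ m, ∑ j, G x (riemAt G x (e i) (e m) (e k)) (e j) *
        (ricAt G x (e k) (e m) * ricAt G x (e i) (e j)) := by
    intro k i
    rw [sharpAt_eq_sum_frame e he hi hs (ricAt G x (e k))]
    simp only [← riemCLM_apply, map_sum, map_smul, _root_.sum_apply, _root_.smul_apply,
      smul_eq_mul]
    refine Finset.sum_congr rfl fun m _ ↦ ?_
    conv_lhs => rw [← sum_apply_smul_of_orthonormal e he (riemCLM G x (e i) (e m) (e k))]
    simp only [map_sum, map_smul, _root_.sum_apply, _root_.smul_apply, smul_eq_mul,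
      Finset.mul_sum, riemCLM_apply]
    exact Finset.sum_congr rfl fun j _ ↦ by rw [hG.ricAt_comm hx (e j) (e i)]; ring
  simp only [ginv_of_orthonormal e he hi, ite_mul, one_mul, zero_mul, Finset.sum_ite_eq,
    Finset.mem_univ, if_true, h2]
  rw [hG.rmNormSqAt_eq_sum_sq e he hx, normSqAt_eq_sum_frame e he hi hs (ricAt G x)]
  exact abs_sum_quartic_le (fun a c i j ↦ G x (riemAt G x (e a) (e c) (e i)) (e j))
    (fun i j ↦ ricAt G x (e i) (e j))

/-! ### The inequality `Δ_f |Ric|² ≥ 2|∇Ric|² + 4λ|Ric|² − 4|Rm| |Ric|²` -/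

/-- **`Δ|Ric|² − d|Ric|²(∇f) ≥ 2|∇Ric|² + 4λ|Ric|² − 4|Rm| |Ric|²` on a gradient Ricci soliton**
(Munteanu–Wang 2015, the first display (F1) of the proof of Lemma 1.2, with the explicit constant
`c = 4` and for a general soliton constant `λ`): for metric components with `Ric + Hess f = λG` on
`V`, at a point `x ∈ V` where `G x` is positive definite, in any basis `b`
(`|∇Ric|² = Σ g^{kl}⟨∇_{b_k}Ric, ∇_{b_l}Ric⟩`, `|Rm| = √(|Rm|²_G)`). The drift identity
`IsMetricOn.lapAt_normSqAt_ricAt_sub_fderiv_of_soliton` and the Cauchy–Schwarz bound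
`IsMetricOn.abs_rmRic_ricAt_le_of_orthonormal` in an orthonormal basis (`exists_orthonormal_basis`).
[cite: MunteanuWang2015, Lemma 1.2 (proof, (F1))] -/
theorem IsMetricOn.lapAt_normSqAt_ricAt_sub_fderiv_ge_of_soliton {ι : Type*} [Fintype ι]
    (b : Basis ι ℝ E) (hG : IsMetricOn G V) (hx : x ∈ V) (hpos : ∀ v : E, v ≠ 0 → 0 < G x v v)
    (hf : ContDiffOn ℝ ∞ f V)
    (hsol : ∀ y ∈ V, ∀ v w, ricAt G y v w + hessAt G f y v w = lam * G y v w) :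
    2 * (∑ k, ∑ l, ginv G b x k l *
        pairAt G x (cov₂At G (ricAt G) x (b k)) (cov₂At G (ricAt G) x (b l)))
      + 4 * lam * normSqAt G x (ricAt G x)
      - 4 * Real.sqrt (rmNormSqAt G x) * normSqAt G x (ricAt G x) ≤
    lapAt G (fun y ↦ normSqAt G y (ricAt G y)) x
      - fderiv ℝ (fun y ↦ normSqAt G y (ricAt G y)) x (sharpAt G x (fderiv ℝ f x)) := by
  obtain ⟨e, he⟩ := exists_orthonormal_basis (hG.symm x hx) hpos
  rw [hG.lapAt_normSqAt_ricAt_sub_fderiv_of_soliton b e hx hf hsol]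
  have hB := (le_abs_self _).trans (hG.abs_rmRic_ricAt_le_of_orthonormal e he hx)
  linarith

/-- **Munteanu–Wang 2015, (1.10) = (F1): `Δ_f |Ric|² ≥ 2|∇Ric|² + 2|Ric|² − 4|Rm| |Ric|²` on a
normalised gradient shrinker `Ric + Hess f = ½G`**, in coordinates: at `x ∈ V` with `G x` positive
definite, in any basis `b`,
`2 Σ g^{kl}⟨∇_{b_k}Ric, ∇_{b_l}Ric⟩ + 2|Ric|² − 4√(|Rm|²)|Ric|² ≤ Δ|Ric|² − d|Ric|²(♯Df)`
(`Δ_f = Δ − ⟨∇f, ∇·⟩`; the source keeps only `−c|Rm||Ric|²`, absorbing `2|Ric|² ≥ 0`).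
[cite: MunteanuWang2015, Lemma 1.2 (proof, (F1))] -/
theorem IsMetricOn.lapAt_normSqAt_ricAt_sub_fderiv_ge_of_shrinker {ι : Type*} [Fintype ι]
    (b : Basis ι ℝ E) (hG : IsMetricOn G V) (hx : x ∈ V) (hpos : ∀ v : E, v ≠ 0 → 0 < G x v v)
    (hf : ContDiffOn ℝ ∞ f V)
    (hsol : ∀ y ∈ V, ∀ v w, ricAt G y v w + hessAt G f y v w = (1 / 2 : ℝ) * G y v w) :
    2 * (∑ k, ∑ l, ginv G b x k l *
        pairAt G x (cov₂At G (ricAt G) x (b k)) (cov₂At G (ricAt G) x (b l)))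
      + 2 * normSqAt G x (ricAt G x)
      - 4 * Real.sqrt (rmNormSqAt G x) * normSqAt G x (ricAt G x) ≤
    lapAt G (fun y ↦ normSqAt G y (ricAt G y)) x
      - fderiv ℝ (fun y ↦ normSqAt G y (ricAt G y)) x (sharpAt G x (fderiv ℝ f x)) := by
  have h := hG.lapAt_normSqAt_ricAt_sub_fderiv_ge_of_soliton b hx hpos hf hsol
  have h2 : (4 : ℝ) * (1 / 2) = 2 := by norm_num
  rw [h2] at h
  exact h

end MetricCoord

end Literature.Geometry.Lorentzian

end
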